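import Mathlib
import HarnessLib
import Summits.HubbardSuperconductivity.HubbardSuperconductivity.Theorems.KLProgrammeKLRegimeEngineScaleZeroIsoTupleG5
import Summits.HubbardSuperconductivity.HubbardSuperconductivity.Theorems.KLProgrammeKLRegimeEngineV8DefsU4
import Summits.HubbardSuperconductivity.HubbardSuperconductivity.Theorems.KLProgrammeKLRegimeEngineScaleZeroE4OverlapTimeExplicit
import Summits.HubbardSuperconductivity.HubbardSuperconductivity.Theorems.KLProgrammeKLRegimeEngineThresholdBridges
import Summits.HubbardSuperconductivity.HubbardSuperconductivity.Theorems.KLProgrammeKLRegimeEngineScaleZeroE1Gfr0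
import Summits.HubbardSuperconductivity.HubbardSuperconductivity.Theorems.KLProgrammeKLRegimeEngineScaleZeroE1Regime

/-!
# (E5-S)₀ and the multiplier time moment `T_T` under EXACTLY the binders of the GEN-6 engine stub `stub_engine_scale0`
# (stmt-HubbardSuperconductivity-20236 `KLRegimeEngineV16`: thresholds `klEngC₃3`, **`klEngU₀4`**, `klEngL₃`, `klEngM₃`; package `klEngGeo5`)

Cell `gate-hubbard-kl`, seat p4 (C5a lead; multiplier lane), g8.  The gen-6 engine child (born 2026-08-27T08:03Z, registered skeleton
8524e294bc0b68a6 of p1 g9) binds `U ≤ klEngU₀4 P R c` (k3c2-p2's `…EngineV8DefsU4`, `klEngU₀4 ≤ klEngU₀3`) where gen 5 had `klEngU₀3`.  This file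
re-keys p4's scale-`0` conjunct and time-moment number to those binders — one-liners over `le_klEngU₀3_of_le_klEngU₀4`:

* **`isoTupleL1AtS_zero_klEngGeo5_of_klEngU₀4`** — `IsoTupleL1AtS L M klEngGeo5 P β U μ K 0`, the fifth conjunct of the gen-6
  `stub_engine_scale0`, UNCONDITIONAL under its binders;
* **`timeMoment_klAnisoFamily_zero_le_of_klEng`** — the time part `T_T` of k3c2-p1's hT (`…ScaleZeroE4TorusSums`) under the same binders:
  `T_T ≤ C_T(B)·(M/β)` (the frame-side hypotheses of `timeMoment_klAnisoFamily_zero_le_explicit` discharged from `P.WF`, `R.WF2`,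
  `U ≤ klEngU₀4`, `klBetaMin ≤ β`, `klEngL₃ ≤ L`, `klEngM₃ ≤ M` by k3c2-p1's / k3c2-p3's / p3's threshold bridges).

Everything is proved; no definitions, no named facts, no sorry. [cite: BenfattoGiulianiMastropietro2006, §2.6 (2.81), Lemma 2.2 (2.36aa)]
-/

namespace Summit.HubbardSuperconductivity.HubbardSuperconductivity.Theorems.EngineV8

set_option linter.dupNamespace false -- summit = problem name (single-conjunct summit), D-0017

noncomputable section

open Real Finset Literature.MathematicalPhysics.QuantumLattice Literature.Probability.LatticeModels
open Summit.HubbardSuperconductivity.HubbardSuperconductivity.Theorems.KLRegimeSplit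
open Summit.HubbardSuperconductivity.HubbardSuperconductivity.Theorems.KLProgrammeLegKernels
open scoped ComplexConjugate

/-- **(E5-S)₀ at `klEngGeo5` under the GEN-6 binders** (`U ≤ klEngU₀4 P R c`): `IsoTupleL1AtS L M klEngGeo5 P β U μ K 0`.
[cite: BenfattoGiulianiMastropietro2006, §2.6 (2.81)] -/
theorem isoTupleL1AtS_zero_klEngGeo5_of_klEngU₀4 (P : SplitConsts) (R : RenConsts) (c : ℝ) (hP : P.WF) (hR : R.WF2) (hc : 0 < c)
    (hc₃ : c ≤ klEngC₃3 P R) (μ : ℝ) (hμ : μ ∈ klWindowC) (U : ℝ) (hU : 0 < U) (hU₀ : U ≤ klEngU₀4 P R c) (β : ℝ)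
    (hβ : klBetaMin ≤ β) (hβc : β ≤ Real.exp (c / U ^ 2)) (K : TrigPolyC4v) (hK : FrameOK R U (nScales β) μ K) (L M : ℕ)
    [NeZero L] [NeZero M] (hL : klEngL₃ β U ≤ L) (hM : klEngM₃ β U L ≤ M) : IsoTupleL1AtS L M klEngGeo5 P β U μ K 0 :=
  isoTupleL1AtS_zero_klEngGeo5 P R c hP hR hc hc₃ μ hμ U hU (le_klEngU₀3_of_le_klEngU₀4 hU₀) β hβ hβc K hK L M hL hM

/-- **The multiplier time moment `T_T` under the GEN-6 binders of `stub_engine_scale0`**: with `B ≥ 1` bounding the unit-profile derivatives of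
orders `≤ 6`, for every sector `ω` and charge `c`,
`(|β|L²)⁻¹ Σ_{dw} (β/4M)·cyclicDist(dw.1 0, 0)·‖Σ_k F_ω(k) Χ_c(k;dw)‖ ≤ C_T(B)·(M/β)` — the `(β/4M)·cyclicDist` term of k3c2-p1's hT.
[cite: BenfattoGiulianiMastropietro2006, Lemma 2.2 (2.36aa) and (3.3)] -/
theorem timeMoment_klAnisoFamily_zero_le_of_klEng (P : SplitConsts) (R : RenConsts) (c : ℝ) (hP : P.WF) (hR : R.WF2) (hc : 0 < c)
    (hc₃ : c ≤ klEngC₃3 P R) (μ : ℝ) (hμ : μ ∈ klWindowC) (U : ℝ) (hU : 0 < U) (hU₀ : U ≤ klEngU₀4 P R c) (β : ℝ)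
    (hβ : klBetaMin ≤ β) (hβc : β ≤ Real.exp (c / U ^ 2)) (K : TrigPolyC4v) (hK : FrameOK R U (nScales β) μ K) (L M : ℕ)
    [NeZero L] [NeZero M] (hL : klEngL₃ β U ≤ L) (hM : klEngM₃ β U L ≤ M) {B : ℝ} (hB1 : 1 ≤ B)
    (hB : ∀ i ≤ 6, ∀ u, ‖iteratedDeriv i (bgmCutoffSqUnit klE0) u‖ ≤ B) (ω : Fin (sectorCount 0)) (cc : Fin 2) :
    1 / (|β| * (L : ℝ) ^ 2) *
        ∑ dw : TorusSite 1 (2 * (2 * M)) × TorusSite 2 L,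
          (β / (2 * (2 * M) : ℕ) * cyclicDist (2 * (2 * M)) (dw.1 0) 0) *
            ‖∑ k : FreqMomentum L M, klAnisoFamily L M β μ K klE0 0 ω k *
              (if cc = 0 then torusChar (fun _ : Fin 1 => ((k.1 : ℕ) : ZMod (2 * (2 * M)))) dw.1 * torusChar k.2 dw.2
                else (starRingEnd ℂ) (torusChar (fun _ : Fin 1 => ((k.1 : ℕ) : ZMod (2 * (2 * M)))) dw.1 * torusChar k.2 dw.2))‖ ≤
      (128 * Real.pi * (2 + 6 * Real.pi * ((22484224 / 9 + 7180 / 3 * sectorCircLineConst) + 1)) *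
        Real.sqrt ((1 + 64 * Real.pi ^ 2) * (1793 / 32 + 704) * (7 * (1 + (720 * B) ^ 2)) / (16 * Real.pi))) * (M / β) := by
  have _ := hc₃; have _ := hβc; have _ := hP; have _ := hc
  have hU₃ : U ≤ klEngU₀3 P R c := le_klEngU₀3_of_le_klEngU₀4 hU₀
  obtain ⟨hL15, -, -, hβM, hβ3M, -⟩ := scaleZero_regime_sizes (U := U) hβ hL hM
  have hβ128 : (128 : ℝ) ≤ β := le_trans (by norm_num [klBetaMin]) hβ
  have hMβ : klE0 * β ≤ Real.pi * (2 * M - 13) := by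
    have hE : klE0 = 1 / 32 := by norm_num [klE0]
    have hπ3 : (3 : ℝ) < Real.pi := Real.pi_gt_three
    have hβ2 : β ^ 3 = β * β ^ 2 := by ring
    have hbig : 2 * (128 : ℝ) ^ 2 * β ≤ 2 * β ^ 3 := by rw [hβ2]; nlinarith
    rw [hE]
    nlinarith
  exact timeMoment_klAnisoFamily_zero_le_explicit hK hR.wf.2.2 hμ (gfr0_abs_mul_le_of_le_klEngU₀3 hU hU₃) hL15 hβ hβM hMβ hB1 hB ω cc

end

end Summit.HubbardSuperconductivity.HubbardSuperconductivity.Theorems.EngineV8
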